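import Summits.KontsevichZagierPeriods.Zeta5Search.Barrier.ConeGammaCuspSlopeLipschitz
import Summits.KontsevichZagierPeriods.Zeta5Search.Barrier.ConeGammaS7Defect

/-!
# ζ(5) search — BARRIER: EVERY PERMUTATION TERM EQUIDISTRIBUTES EXACTLY — the translate integral and the cusp
# slope are `S₇`-CLASS FUNCTIONS, and pure max-excess

HONEST FRAMING (cell `pub-zeta5`): systematic search; no irrationality claim unless kernel-certified. MODEL objects
under Brown–Zudilin's (28)+(30) accounting ([BZ22] = arXiv:2210.03391; (28) observed, not proved); nothing here is a
statement about `ζ(5)`, any `γ` of record, the cone's supremum (C2 OPEN) or the value / sign of the cusp slope or of a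
translate integral at a named direction (DATA of the cell); S-E stays CONJECTURED (its content is the CONSTANT — the
cancellation this file locates but does not quantify); records in print UNMOVED. Prover P2 g40 (item «THE SIGNED JUMP
MASSES», file (1) of the item; plan INBOX 2026-08-28).

BZ's saving step function is a MAXIMUM, `𝒩 = max_{σ∈S₇} torusTerm · σ` (`ConeGammaTorus`), of seventeen-term floor
combinations `torusTerm θ σ = Σ_{i∈F} (⌊φ_i θ⌋ − ⌊φ_i(σθ)⌋)` whose linear parts cancel (`Σ_{i∈F} φ_i` is `S₇`-invariant,
`sum_FIdx_phiForm_permS`). This file shows that along the closed orbit of a rational direction EACH TERM SEPARATELY has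
period average EXACTLY ZERO on EVERY rigid translate — so every object of the cusp programme built from the translate
integral `P(δ) = ∫₀ᵀ 𝒩(u·s(a) + δ) du` (the cusp slope `σ`, the chamber weights / signed jump masses, Λ, the translate defect
of (TD_A)) is a property of the MAXIMISATION ALONE, and is an `S₇`-CLASS FUNCTION although `Φ` itself is not (P2 g20's
F-entropy cocycle `phi30_permAct`):
* `integral_floor_unit`, `integral_floor_nat` (`∫₀ⁿ ⌊y⌋ dy = n(n−1)/2`), **`integral_floor_line_period`** — for `x > 0`,
  `0 ≤ T`, `T·x = N ∈ ℤ` and every offset `c`: `∫₀ᵀ ⌊s·x + c⌋ ds = T·(N − 1)/2 + T·c` (exact: affine in the rate `x` and in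
  the offset `c`, which is what makes the `F`-sum and the `σF`-sum cancel);
* **`integral_torusTerm_translate_eq_zero`** — for `a` with all 28 forms positive, `T ≥ 0` a period (`T·h_k(a) ∈ ℤ`),
  EVERY `σ ∈ S₇` and EVERY `δ ∈ ℝ⁸`: **`∫₀ᵀ torusTerm (u·s(a) + δ) σ du = 0`** (no-cancellation estimates see `T·Σ|φ_k|`
  per term here; the truth is `0`);
* **`translateIntegral_eq_integral_excess`** — hence `P(δ) = ∫₀ᵀ (𝒩 − torusTerm · σ)(u·s(a) + δ) du` for every `σ`, the
  integral of the non-negative MAX-EXCESS over any fixed permutation;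
* **`translateIntegral_permAct`** — `P_{g·a,T}(g·δ) = P_{a,T}(δ)` for every `g ∈ S₇` (with P2 g20's `torusN_permS`:
  `𝒩(g·θ) = 𝒩(θ) − torusTerm θ g`, and the term integrates to `0`): THE TRANSLATE INTEGRAL IS A CLASS FUNCTION;
  `h28_permAct_pos`, `hper_permAct` (positivity and periods are class properties);
* `cuspSlope_spec_eventually` (Lemma B at ALL small scales, packaged), **`cuspSlope_permAct`** —
  `cuspSlope (g·a) T (g·δ) = cuspSlope a T δ`: THE CUSP SLOPE IS A CLASS FUNCTION. READING (not separately stated): the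
  chamber weights, the normalised-ray slopes behind `Λ` and the translate defect of (TD_A) are built from `P` and `σ` alone,
  hence class functions too; `Φ`'s `S₇`-defect is the smooth entropy cocycle, so the ROUGH part of `Φ` is `S₇`-invariant.
NOT here (honest): any value at a named direction; the signed jump masses as the GRADIENT of `P` at generic translates
(files (2a)/(2b) `ConeGammaTranslateGradientLocal` / `ConeGammaTranslateGradient`); any constant of S-E; anything about
`γ`, C2, `ζ(5)`.
-/

noncomputable section

open Set MeasureTheory
open scoped Topology

namespace Summit.KontsevichZagierPeriods.Zeta5Search.Barrier.ConeGamma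

/-! ### Exact integrals of one floor -/

/-- `∫₀¹ ⌊y⌋ dy = 0`. -/
theorem integral_floor_unit : ∫ y in (0 : ℝ)..1, (⌊y⌋ : ℝ) = 0 := by
  rw [intervalIntegral.integral_of_le zero_le_one, integral_Ioc_eq_integral_Ioo,
    setIntegral_congr_fun measurableSet_Ioo (g := fun _ : ℝ => (0 : ℝ)) (fun y hy => by
      have : ⌊y⌋ = 0 := Int.floor_eq_zero_iff.mpr ⟨hy.1.le, hy.2⟩
      simp [this])]
  simp

/-- `∫ₙ^{n+1} ⌊y⌋ dy = n` for a natural `n`. -/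
theorem integral_floor_nat_succ (n : ℕ) : ∫ y in (n : ℝ)..((n : ℝ) + 1), (⌊y⌋ : ℝ) = n := by
  have h := intervalIntegral.integral_comp_add_right (a := 0) (b := 1) (fun y : ℝ => (⌊y⌋ : ℝ)) (n : ℝ)
  rw [zero_add, add_comm (1 : ℝ)] at h
  rw [← h]
  have hn : ∀ y : ℝ, (⌊y + (n : ℝ)⌋ : ℝ) = (⌊y⌋ : ℝ) + n := by
    intro y
    rw [show (n : ℝ) = ((n : ℤ) : ℝ) by simp, Int.floor_add_intCast]
    push_cast
    ring
  simp_rw [hn]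
  rw [intervalIntegral.integral_add (intervalIntegrable_floor _ _) intervalIntegrable_const, integral_floor_unit,
    intervalIntegral.integral_const, smul_eq_mul]
  ring

/-- **`∫₀ⁿ ⌊y⌋ dy = n(n−1)/2`** for a natural `n`. -/
theorem integral_floor_nat (n : ℕ) : ∫ y in (0 : ℝ)..(n : ℝ), (⌊y⌋ : ℝ) = (n : ℝ) * ((n : ℝ) - 1) / 2 := by
  induction n with
  | zero => simp
  | succ n ih =>
    rw [← intervalIntegral.integral_add_adjacent_intervals (b := (n : ℝ)) (intervalIntegrable_floor _ _)
      (intervalIntegrable_floor _ _), ih, Nat.cast_succ, integral_floor_nat_succ]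
    ring

/-- **EXACT INTEGRAL OF ONE FLOOR OVER A PERIOD.** For `x > 0`, `0 ≤ T` with `T·x = N ∈ ℤ` and every offset `c`:
`∫₀ᵀ ⌊s·x + c⌋ ds = T·(N − 1)/2 + T·c` — affine in the rate and in the offset. -/
theorem integral_floor_line_period {x T : ℝ} (hx : 0 < x) (hT : 0 ≤ T) {N : ℤ} (hN : T * x = N) (c : ℝ) :
    ∫ s in (0 : ℝ)..T, (⌊s * x + c⌋ : ℝ) = T * ((N : ℝ) - 1) / 2 + T * c := by
  -- the offset: `∫ (⌊sx + c⌋ − ⌊sx⌋) = T·c`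
  have hshift := integral_floor_shift_period hx ⟨N, hN⟩ 0 c
  simp only [add_zero] at hshift
  rw [intervalIntegral.integral_sub (intervalIntegrable_floor_line hx.le c 0 T)
    ((intervalIntegrable_floor_line hx.le 0 0 T).congr fun s _ => by simp only [add_zero])] at hshift
  -- the rate: `∫ ⌊sx⌋ = x⁻¹ ∫₀ᴺ ⌊y⌋ = T(N − 1)/2`
  have h0 : ∫ s in (0 : ℝ)..T, (⌊s * x⌋ : ℝ) = T * ((N : ℝ) - 1) / 2 := by
    have h := integral_floor_line_eq (c := 0) hx hN
    simp only [add_zero] at h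
    rw [h]
    have hN0 : (0 : ℤ) ≤ N := by
      have : (0 : ℝ) ≤ N := by rw [← hN]; positivity
      exact_mod_cast this
    obtain ⟨n, hn⟩ := Int.eq_ofNat_of_zero_le hN0
    have hn' : (N : ℝ) = n := by rw [hn]; simp
    rw [hn', integral_floor_nat n, ← hn', ← hN]
    field_simp
  linarith

/-! ### Every permutation term has period average `0` on every translate -/

/-- **Positivity is a class property**: if all 28 forms of `a` are positive, so are those of `g·a`. -/
theorem h28_permAct_pos {a : Dir} (hpos : ∀ k, 0 < h28 a k) (g : Equiv.Perm (Fin 7)) (k : Fin 28) :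
    0 < h28 (permAct g a) k := by
  obtain ⟨k', hk'⟩ := exists_h28_eq_permAct a g k
  rw [hk']
  exact hpos k'

/-- **Periods are a class property**: a period `T` of the orbit of `a` (`T·h_k(a) ∈ ℤ` for all `k`) is a period for `g·a`. -/
theorem hper_permAct {a : Dir} {T : ℝ} (hper : ∀ k : Fin 28, ∃ z : ℤ, T * h28 a k = z) (g : Equiv.Perm (Fin 7))
    (k : Fin 28) : ∃ z : ℤ, T * h28 (permAct g a) k = z := by
  obtain ⟨k', hk'⟩ := exists_h28_eq_permAct a g k
  rw [hk']
  exact hper k'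

/-- **EVERY PERMUTATION TERM EQUIDISTRIBUTES EXACTLY.** For a direction `a` with all 28 forms positive, `T ≥ 0` a period
(`T·h_k(a) ∈ ℤ`), every `σ ∈ S₇` and EVERY translate `δ ∈ ℝ⁸`: `∫₀ᵀ torusTerm (u·s(a) + δ) σ du = 0`. (Each floor
integrates to `T(T·h − 1)/2 + T·φ(δ)` — affine in the rate `h` and the offset; the `F`-sum and the `σF`-sum of the rates
agree (`sum_FIdx_h28_permAct`) and so do those of the offsets (`sum_FIdx_phiForm_permS`).) -/
theorem integral_torusTerm_translate_eq_zero {a : Dir} (hpos : ∀ k, 0 < h28 a k) {T : ℝ} (hT : 0 ≤ T)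
    (hper : ∀ k : Fin 28, ∃ z : ℤ, T * h28 a k = z) (σ : Equiv.Perm (Fin 7)) (δ : Fin 8 → ℝ) :
    ∫ u in (0 : ℝ)..T, (torusTerm (u • sParam a + δ) σ : ℝ) = 0 := by
  have hpos' := h28_permAct_pos hpos σ
  have hper' := hper_permAct hper σ
  -- the integrand, floor by floor
  have hint : ∀ u : ℝ, (torusTerm (u • sParam a + δ) σ : ℝ) =
      ∑ i ∈ FIdx, ((⌊u * h28 a i + phiForm δ i⌋ : ℝ) - ⌊u * h28 (permAct σ a) i + phiForm (permS σ δ) i⌋) := by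
    intro u
    unfold torusTerm
    push_cast
    refine Finset.sum_congr rfl fun i _ => ?_
    rw [phiForm_line, phiForm_permS_line]
  simp_rw [hint]
  have hI : ∀ i ∈ FIdx, IntervalIntegrable
      (fun u : ℝ => ((⌊u * h28 a i + phiForm δ i⌋ : ℝ) - ⌊u * h28 (permAct σ a) i + phiForm (permS σ δ) i⌋))
      volume 0 T := fun i _ =>
    (intervalIntegrable_floor_line (hpos i).le _ 0 T).sub (intervalIntegrable_floor_line (hpos' i).le _ 0 T)
  rw [intervalIntegral.integral_finsetSum hI]
  have hval : ∀ i ∈ FIdx,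
      (∫ u in (0 : ℝ)..T, ((⌊u * h28 a i + phiForm δ i⌋ : ℝ) - ⌊u * h28 (permAct σ a) i + phiForm (permS σ δ) i⌋))
        = (T * (T * h28 a i) / 2 + T * phiForm δ i)
          - (T * (T * h28 (permAct σ a) i) / 2 + T * phiForm (permS σ δ) i) := by
    intro i _
    obtain ⟨N, hN⟩ := hper i
    obtain ⟨N', hN'⟩ := hper' i
    rw [intervalIntegral.integral_sub (intervalIntegrable_floor_line (hpos i).le _ 0 T)
      (intervalIntegrable_floor_line (hpos' i).le _ 0 T), integral_floor_line_period (hpos i) hT hN,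
      integral_floor_line_period (hpos' i) hT hN', ← hN, ← hN']
    ring
  rw [Finset.sum_congr rfl hval, Finset.sum_sub_distrib]
  have h1 := sum_FIdx_h28_permAct σ a
  have h2 := sum_FIdx_phiForm_permS σ δ
  simp only [Finset.sum_add_distrib, ← Finset.mul_sum, ← Finset.sum_div] at *
  rw [h1, h2]
  ring

/-- `|torusTerm θ σ| ≤ 7` (as reals): `torusTerm θ σ = 𝒩(θ) − 𝒩(σ·θ)` (`torusN_permS`) with `0 ≤ 𝒩 ≤ 7`. -/
theorem abs_torusTerm_le_seven (θ : Fin 8 → ℝ) (σ : Equiv.Perm (Fin 7)) : |(torusTerm θ σ : ℝ)| ≤ 7 := by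
  have e : (torusTerm θ σ : ℝ) = torusN θ - torusN (permS σ θ) := by
    have := torusN_permS σ θ; push_cast [this]; ring
  have h0 : (0 : ℝ) ≤ torusN θ := by exact_mod_cast torusN_nonneg _
  have h7 : (torusN θ : ℝ) ≤ 7 := by exact_mod_cast torusN_le_seven _
  have h0' : (0 : ℝ) ≤ torusN (permS σ θ) := by exact_mod_cast torusN_nonneg _
  have h7' : (torusN (permS σ θ) : ℝ) ≤ 7 := by exact_mod_cast torusN_le_seven _
  rw [e, abs_le]
  constructor <;> linarith

/-- The excess is non-negative pointwise: `torusTerm θ σ ≤ 𝒩(θ)`. -/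
theorem torusTerm_le_torusN (θ : Fin 8 → ℝ) (σ : Equiv.Perm (Fin 7)) : torusTerm θ σ ≤ torusN θ :=
  Finset.le_sup' (torusTerm θ) (Finset.mem_univ σ)

/-- `u ↦ torusTerm (u·s(a) + δ) σ` is integrable on every bounded interval. -/
theorem intervalIntegrable_torusTerm_line (a : Dir) (δ : Fin 8 → ℝ) (σ : Equiv.Perm (Fin 7)) (α β : ℝ) :
    IntervalIntegrable (fun u : ℝ => (torusTerm (u • sParam a + δ) σ : ℝ)) volume α β :=
  IntervalIntegrable.mono_fun' (g := fun _ => (7 : ℝ)) intervalIntegrable_const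
    (measurable_torusTerm_line a δ σ).aestronglyMeasurable
    (Filter.Eventually.of_forall fun u => by
      dsimp only; rw [Real.norm_eq_abs]; exact abs_torusTerm_le_seven _ _)

/-- **THE TRANSLATE INTEGRAL IS PURE MAX-EXCESS**: for every `σ ∈ S₇`,
`P(δ) = ∫₀ᵀ (𝒩(u·s(a)+δ) − torusTerm (u·s(a)+δ) σ) du`, the integral of the (pointwise non-negative,
`torusTerm_le_torusN`) excess of the maximum over the fixed permutation `σ`. -/
theorem translateIntegral_eq_integral_excess {a : Dir} (hpos : ∀ k, 0 < h28 a k) {T : ℝ} (hT : 0 ≤ T)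
    (hper : ∀ k : Fin 28, ∃ z : ℤ, T * h28 a k = z) (σ : Equiv.Perm (Fin 7)) (δ : Fin 8 → ℝ) :
    translateIntegral a T δ =
      ∫ u in (0 : ℝ)..T, ((torusN (u • sParam a + δ) : ℝ) - torusTerm (u • sParam a + δ) σ) := by
  unfold translateIntegral
  rw [intervalIntegral.integral_sub (intervalIntegrable_torusN_line a δ 0 T)
    (intervalIntegrable_torusTerm_line a δ σ 0 T), integral_torusTerm_translate_eq_zero hpos hT hper σ δ, sub_zero]

/-! ### The translate integral is an `S₇`-class function -/

/-- **THE TRANSLATE INTEGRAL IS A CLASS FUNCTION**: `P_{g·a,T}(g·δ) = P_{a,T}(δ)` for every `g ∈ S₇` (all forms of `a`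
positive, `T ≥ 0` a period). With `𝒩(g·θ) = 𝒩(θ) − torusTerm θ g` (`torusN_permS`) the integrands differ by a
permutation term, which integrates to `0`. -/
theorem translateIntegral_permAct {a : Dir} (hpos : ∀ k, 0 < h28 a k) {T : ℝ} (hT : 0 ≤ T)
    (hper : ∀ k : Fin 28, ∃ z : ℤ, T * h28 a k = z) (g : Equiv.Perm (Fin 7)) (δ : Fin 8 → ℝ) :
    translateIntegral (permAct g a) T (permS g δ) = translateIntegral a T δ := by
  have hint : ∀ u : ℝ, (torusN (u • sParam (permAct g a) + permS g δ) : ℝ) =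
      torusN (u • sParam a + δ) - torusTerm (u • sParam a + δ) g := by
    intro u
    rw [sParam_permAct, ← permS_smul, ← permS_add, torusN_permS]
    push_cast
    ring
  rw [translateIntegral_eq_integral_excess hpos hT hper g δ]
  unfold translateIntegral
  exact intervalIntegral.integral_congr fun u _ => hint u

/-- The same with the displacement written on the side of `a`: `P_{g·a,T}(δ) = P_{a,T}(g⁻¹·δ)`. -/
theorem translateIntegral_permAct' {a : Dir} (hpos : ∀ k, 0 < h28 a k) {T : ℝ} (hT : 0 ≤ T)
    (hper : ∀ k : Fin 28, ∃ z : ℤ, T * h28 a k = z) (g : Equiv.Perm (Fin 7)) (δ : Fin 8 → ℝ) :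
    translateIntegral (permAct g a) T δ = translateIntegral a T (permS g⁻¹ δ) := by
  have h := translateIntegral_permAct hpos hT hper g (permS g⁻¹ δ)
  rwa [permS_permS, inv_mul_cancel, permS_one] at h

/-- In particular `P_{g·a,T}(0) = P_{a,T}(0)`: the saving collected over a period of the closed orbit is a class function. -/
theorem translateIntegral_permAct_zero {a : Dir} (hpos : ∀ k, 0 < h28 a k) {T : ℝ} (hT : 0 ≤ T)
    (hper : ∀ k : Fin 28, ∃ z : ℤ, T * h28 a k = z) (g : Equiv.Perm (Fin 7)) :
    translateIntegral (permAct g a) T 0 = translateIntegral a T 0 := by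
  have h := translateIntegral_permAct hpos hT hper g 0
  have h0 : permS g (0 : Fin 8 → ℝ) = 0 := by ext i; simp [permS_apply]
  rwa [h0] at h

/-! ### The cusp slope is an `S₇`-class function -/

/-- **Lemma B at all small scales, packaged**: there is `ρ₀ > 0` with `P(ρδ) − P(0) = ρ·cuspSlope a T δ` for EVERY
`0 < ρ ≤ ρ₀` (admissibility is downward closed, `admissible_of_le`). -/
theorem cuspSlope_spec_eventually {a : Dir} (hpos : ∀ k, 0 < h28 a k) {T : ℝ} (hT : 0 < T)
    (hper : ∀ k : Fin 28, ∃ z : ℤ, T * h28 a k = z) (δ : Fin 8 → ℝ) :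
    ∃ ρ₀ : ℝ, 0 < ρ₀ ∧ ∀ ρ, 0 < ρ → ρ ≤ ρ₀ →
      translateIntegral a T (ρ • δ) - translateIntegral a T 0 = ρ * cuspSlope a T δ := by
  obtain ⟨ρ₀, hρ₀, h1, h2, hgap⟩ := exists_admissible_scale hpos hT δ
  refine ⟨ρ₀, hρ₀, fun ρ hρ hle => ?_⟩
  obtain ⟨h1', h2', hgap'⟩ := admissible_of_le hpos (T := T) δ hle h1 h2 hgap
  exact cuspSlope_spec hpos hT hper δ hρ h1' h2' hgap'

/-- **THE CUSP SLOPE IS A CLASS FUNCTION**: `cuspSlope (g·a) T (g·δ) = cuspSlope a T δ` for every `g ∈ S₇` (all forms of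
`a` positive, `T > 0` a period). Both are the slope at `0⁺` of the same function `ρ ↦ P(ρδ)` (`translateIntegral_permAct`). -/
theorem cuspSlope_permAct {a : Dir} (hpos : ∀ k, 0 < h28 a k) {T : ℝ} (hT : 0 < T)
    (hper : ∀ k : Fin 28, ∃ z : ℤ, T * h28 a k = z) (g : Equiv.Perm (Fin 7)) (δ : Fin 8 → ℝ) :
    cuspSlope (permAct g a) T (permS g δ) = cuspSlope a T δ := by
  have hpos' := h28_permAct_pos hpos g
  have hper' : ∀ k : Fin 28, ∃ z : ℤ, T * h28 (permAct g a) k = z := hper_permAct hper g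
  obtain ⟨ρ₁, hρ₁, hs₁⟩ := cuspSlope_spec_eventually hpos hT hper δ
  obtain ⟨ρ₂, hρ₂, hs₂⟩ := cuspSlope_spec_eventually hpos' hT hper' (permS g δ)
  set ρ := min ρ₁ ρ₂ with hρdef
  have hρ : 0 < ρ := lt_min hρ₁ hρ₂
  have e1 := hs₁ ρ hρ (min_le_left _ _)
  have e2 := hs₂ ρ hρ (min_le_right _ _)
  rw [← permS_smul, translateIntegral_permAct hpos hT.le hper, translateIntegral_permAct_zero hpos hT.le hper, e1]
    at e2
  exact (mul_left_cancel₀ hρ.ne' e2).symm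

/-- The same with the displacement on the side of `a`: `cuspSlope (g·a) T δ = cuspSlope a T (g⁻¹·δ)`. -/
theorem cuspSlope_permAct' {a : Dir} (hpos : ∀ k, 0 < h28 a k) {T : ℝ} (hT : 0 < T)
    (hper : ∀ k : Fin 28, ∃ z : ℤ, T * h28 a k = z) (g : Equiv.Perm (Fin 7)) (δ : Fin 8 → ℝ) :
    cuspSlope (permAct g a) T δ = cuspSlope a T (permS g⁻¹ δ) := by
  have h := cuspSlope_permAct hpos hT hper g (permS g⁻¹ δ)
  rwa [permS_permS, inv_mul_cancel, permS_one] at h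

end Summit.KontsevichZagierPeriods.Zeta5Search.Barrier.ConeGamma

end
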